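import Mathlib.Data.Fintype.Card
import Mathlib.Data.Fintype.EquivFin
import Mathlib.Data.Finset.Card
import HarnessLib

/-!
# The slice test at margin μ = 3 — the third instance of N7F §3.9 (a)

Cell `pub-hsemireg`, widening group W5, seat w5-n7-1 (gen 12); file of record `widen/W5/N7-FEASIBILITY-w5n7.md` (N7F)
§3.9 (a) «SLICE TEST IN TRIANGLE LANGUAGE … Instances: μ = 1 ⟹ v lies in no triangle (LIGHT-LEVEL LEMMA); μ = 2 ⟹ the
triangles at v form a partial matching N_a(v) ↔ N_b(v); μ = 3 ⟹ Tri-degrees ≤ 2 and Tri_v ≠ K_{2,2} ⊔ (disjoint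
edge)». The instances μ = 1, 2 (and the exactness of the test) are the sibling leg `SliceTestBalance` (w5-n7-1 g11,
ladder k = 347); this leaf is the instance μ = 3 and shares no statement with it.

SETTING (as in `SliceTestBalance`). A slice graph is a relation `E : α → β → Prop` between the two neighbour sets of
the slicing vertex (`E a b` = «the triangle (a, b, v) is ABSENT»); the encoders' slice test is (D) «every vertex on
either side has an `E`-neighbour» ∧ (P) «every CLOSED split (`E a b → (a ∈ SA ↔ b ∈ SB)`) with all four parts
`SA, SAᶜ, SB, SBᶜ` non-empty has `#SA = #SB`». What is kernel-checked, for `#α = #β = 3`: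

* `slice_three` — (D) ∧ (P) ⟺ (D) ∧ «`E` is NOT of the form `E a b ↔ (a = a₀ ↔ b ≠ b₀)` for some `a₀, b₀`», i.e.
  the slice graph is not the disjoint union `K_{1,2} ⊔ K_{2,1}` of two unbalanced stars (the only closed unbalanced
  split shape on 3 + 3 vertices without isolated vertices);
* `slice_three_tri` — the same in triangle language (`Tri a b` = «the triangle is present», `E = ¬Tri`): the test
  passes iff every vertex has Tri-degree ≤ 2 (misses at least one triangle) and `Tri` is NOT «`Tri a b ↔ (a = a₀ ↔
  b = b₀)`» = the disjoint edge `(a₀, b₀)` ⊔ the `K_{2,2}` on the other four vertices — N7F's printed μ = 3 line.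

HONEST FRAMING: finite combinatorics on 3 + 3 vertices; RULE R′'s derivation, the encoders and the designs are not
formalised; nothing here is a statement about a variety, a sheaf or a Hodge class, and nothing here bears on
HC / HC_CM / HC_AV.
-/

open Finset

namespace Summit.Ventures.HSemireg.SliceTestThree

variable {α β : Type*}

/-- The unbalanced shape forces the whole relation: if a closed split has `SA`-membership «`≠ a₀`» and
`SB`-membership «`= b₀`» (or the mirror image), and every vertex has a neighbour, then
`E a b ↔ (a = a₀ ↔ b ≠ b₀)` for all `a, b`. -/
theorem shape_of_closed_split (E : α → β → Prop) (hDa : ∀ a, ∃ b, E a b) (hDb : ∀ b, ∃ a, E a b) (a₀ : α)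
    (b₀ : β) (hcl : ∀ a b, E a b → (a = a₀ ↔ b ≠ b₀)) : ∀ a b, E a b ↔ (a = a₀ ↔ b ≠ b₀) := by
  intro a b
  refine ⟨hcl a b, fun h => ?_⟩
  by_cases hb : b = b₀
  · -- then a ≠ a₀; the neighbour of a must be b₀ = b
    have ha : a ≠ a₀ := fun ha => (h.1 ha) hb
    obtain ⟨b', hb'⟩ := hDa a
    have : ¬ b' ≠ b₀ := fun hne => ha ((hcl a b' hb').2 hne)
    rw [not_not] at this
    rw [hb, ← this]
    exact hb'
  · -- then a = a₀; the neighbour of b must be a₀ = a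
    have ha : a = a₀ := h.2 hb
    obtain ⟨a', ha'⟩ := hDb b
    have : a' = a₀ := (hcl a' b ha').2 hb
    rw [ha, ← this]
    exact ha'

variable [Fintype α] [Fintype β] [DecidableEq α] [DecidableEq β]

/-- In a 3-element type, a non-empty finset with non-empty complement has 1 or 2 elements, and its complement has
the other count. -/
theorem card_cases_of_three (S : Finset α) (hα : Fintype.card α = 3) (hS : S.Nonempty) (hSc : Sᶜ.Nonempty) :
    (S.card = 1 ∧ Sᶜ.card = 2) ∨ (S.card = 2 ∧ Sᶜ.card = 1) := by
  have h1 : 0 < S.card := card_pos.2 hS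
  have h2 : 0 < Sᶜ.card := card_pos.2 hSc
  have h3 : Sᶜ.card = 3 - S.card := by rw [card_compl, hα]
  have h4 : S.card ≤ 3 := hα ▸ card_le_univ S
  omega

/-- A finset whose complement is the singleton `{x}` is «everything but `x`». -/
theorem mem_iff_ne_of_compl_eq_singleton {S : Finset α} {x : α} (h : Sᶜ = {x}) (y : α) : y ∈ S ↔ y ≠ x := by
  rw [← not_iff_not, not_not, ← mem_singleton, ← h, mem_compl]

/-- **The slice test at μ = 3.** For `#α = #β = 3`: (D) ∧ (P) holds iff (D) holds and the slice graph is NOT of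
the shape `E a b ↔ (a = a₀ ↔ b ≠ b₀)` (the disjoint union of the stars `{a₀} × (β ∖ {b₀})` and
`(α ∖ {a₀}) × {b₀}`, whose components are unbalanced 1 : 2 and 2 : 1). -/
theorem slice_three (E : α → β → Prop) (hα : Fintype.card α = 3) (hβ : Fintype.card β = 3) :
    (((∀ a, ∃ b, E a b) ∧ (∀ b, ∃ a, E a b)) ∧
        ∀ (SA : Finset α) (SB : Finset β), (∀ a b, E a b → (a ∈ SA ↔ b ∈ SB)) →
          SA.Nonempty → SAᶜ.Nonempty → SB.Nonempty → SBᶜ.Nonempty → SA.card = SB.card) ↔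
      ((∀ a, ∃ b, E a b) ∧ (∀ b, ∃ a, E a b)) ∧ ¬ ∃ a₀ b₀, ∀ a b, E a b ↔ (a = a₀ ↔ b ≠ b₀) := by
  constructor
  · rintro ⟨hD, hP⟩
    refine ⟨hD, ?_⟩
    rintro ⟨a₀, b₀, h⟩
    -- the closed split (α ∖ {a₀}, {b₀}) is unbalanced 2 : 1
    obtain ⟨a₁, ha₁⟩ := Fintype.exists_ne_of_one_lt_card (by rw [hα]; omega) a₀
    obtain ⟨b₁, hb₁⟩ := Fintype.exists_ne_of_one_lt_card (by rw [hβ]; omega) b₀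
    have hbad := hP (univ.erase a₀) {b₀} (fun a b hab => by
        rw [mem_erase, mem_singleton, and_iff_left (mem_univ a)]
        have := h a b |>.1 hab
        tauto)
      ⟨a₁, mem_erase.2 ⟨ha₁, mem_univ _⟩⟩
      ⟨a₀, by rw [mem_compl, mem_erase]; exact fun h => h.1 rfl⟩
      ⟨b₀, mem_singleton_self _⟩
      ⟨b₁, by rw [mem_compl, mem_singleton]; exact hb₁⟩
    rw [card_erase_of_mem (mem_univ a₀), card_univ, hα, card_singleton] at hbad
    omega
  · rintro ⟨hD, hN⟩
    refine ⟨hD, ?_⟩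
    intro SA SB hcl hA hAc hB hBc
    by_contra hne
    rcases card_cases_of_three SA hα hA hAc with ⟨hA1, hA2⟩ | ⟨hA2, hA1⟩ <;>
      rcases card_cases_of_three SB hβ hB hBc with ⟨hB1, hB2⟩ | ⟨hB2, hB1⟩
    · exact hne (hA1.trans hB1.symm)
    · -- SA = {a₁}, SBᶜ = {b₁}: membership is «a = a₁», «b ≠ b₁»
      obtain ⟨a₁, ha₁⟩ := card_eq_one.1 hA1
      obtain ⟨b₁, hb₁⟩ := card_eq_one.1 hB1
      refine hN ⟨a₁, b₁, shape_of_closed_split E hD.1 hD.2 a₁ b₁ fun a b hab => ?_⟩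
      rw [← mem_iff_ne_of_compl_eq_singleton hb₁ b, ← mem_singleton, ← ha₁]
      exact hcl a b hab
    · -- SAᶜ = {a₀}, SB = {b₀}: membership is «a ≠ a₀», «b = b₀»
      obtain ⟨a₀, ha₀⟩ := card_eq_one.1 hA1
      obtain ⟨b₀, hb₀⟩ := card_eq_one.1 hB1
      refine hN ⟨a₀, b₀, shape_of_closed_split E hD.1 hD.2 a₀ b₀ fun a b hab => ?_⟩
      have h1 := hcl a b hab
      rw [mem_iff_ne_of_compl_eq_singleton ha₀ a, hb₀, mem_singleton] at h1
      tauto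
    · exact hne (hA2.trans hB2.symm)

/-- **N7F §3.9 (a), instance μ = 3, in triangle language.** With `Tri a b` = «the triangle (a, b, v) is present»
and the slice graph `E = ¬Tri`: the slice test passes iff every vertex misses at least one triangle (Tri-degree
≤ 2 on either side) and `Tri` is NOT «`Tri a b ↔ (a = a₀ ↔ b = b₀)`» — the disjoint edge `(a₀, b₀)` together with
the complete bipartite `K_{2,2}` on the remaining `2 + 2` vertices. -/
theorem slice_three_tri (Tri : α → β → Prop) (hα : Fintype.card α = 3) (hβ : Fintype.card β = 3) :
    (((∀ a, ∃ b, ¬ Tri a b) ∧ (∀ b, ∃ a, ¬ Tri a b)) ∧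
        ∀ (SA : Finset α) (SB : Finset β), (∀ a b, ¬ Tri a b → (a ∈ SA ↔ b ∈ SB)) →
          SA.Nonempty → SAᶜ.Nonempty → SB.Nonempty → SBᶜ.Nonempty → SA.card = SB.card) ↔
      ((∀ a, ∃ b, ¬ Tri a b) ∧ (∀ b, ∃ a, ¬ Tri a b)) ∧
        ¬ ∃ a₀ b₀, ∀ a b, Tri a b ↔ (a = a₀ ↔ b = b₀) := by
  rw [slice_three (fun a b => ¬ Tri a b) hα hβ]
  refine and_congr Iff.rfl (not_congr (exists_congr fun a₀ => exists_congr fun b₀ =>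
    forall_congr' fun a => forall_congr' fun b => ?_))
  constructor
  · intro h
    rw [← not_iff_not, h]
    tauto
  · intro h
    rw [h]
    tauto

end Summit.Ventures.HSemireg.SliceTestThree
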